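import Literature.MathematicalPhysics.QuantumFieldTheory.Balaban1983to89.B4Delta112ZeroTorusCube
import Literature.MathematicalPhysics.QuantumFieldTheory.BalabanImbrieJaffe1984to88.BIJ88NeumannPropagatorFlatDecayLevel

/-!
# `BalabanImbrieJaffe1984to88.BIJ88Close231WholeTorusFlat` — T. Bałaban, J. Imbrie, A. Jaffe, *Effective action and cluster properties of the
abelian Higgs model*, Commun. Math. Phys. **114** (1988) 257–315 [BalabanImbrieJaffe1988], §2 (2.31) and (2.35) p. 263 [PDF 7] **WITH THE
REGION `Ω = T_η` (THE WHOLE TORUS) AT EVERY FLAT / PURE-GAUGE BACKGROUND `u = 1^h`, IN LEVEL-`k` UNITS**: the localized propagator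
`G_{k,loc}(1^h)` is close to the whole-torus propagator `G_k(T_η,1^h)`, and the localized form `Δ_{k,loc}(1^h)` is close to the whole-torus
region form `Δ_k(T_η,1^h)`, at distance `O(r(e_k))` inside every localization cube — p31 gen 17's `close231_flat_kernel_level` /
`opClose231_flat_level` / `close235_flat_level` (outer region `Ω₀` = a no-wrap box) with the input swap «[6] (1.11)–(1.12) at `A = 0` for
`□ ⊂ Ω₀`» ↦ r01 g24's `B4Delta112ZeroTorusCube.close112_flat_torus(_kernel)` («`□ ⊂ T_η`», p341890) and «[6] (1.10) for `G_k(Ω₀,1^h)`» ↦ r18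
g19's `BIJ88NeumannPropagatorFlatDecayLevel.decay110_flat(_kernel)_level` (`G_k(T_η,1^h)`).

statement-level skeleton of published theorems with citation tags; proofs where landed; nothing here is a claim about the Yang–Mills mass gap

PDF held: `paper:balaban1988-cmp114-bij-abelian-higgs-effective-action` (journal page = PDF page + 256; p. 263 = PDF 7, text layer `lit read … --pages
7-8` re-read this session).

CITATION HEADER (lean-in-tree rule).  lit-balaban cell (HOME `run/shared/lean/pub/lit-balaban/`), Phase 2, seat r18 gen 22 (unit `lit-balaban-r18`,
literature-prover-lit-balaban-r18-g22-0; C2 §§1–4 fold owner), free-target protocol G.5-34(d), TAKING line HOME/STATUS.md 2026-08-22T22:01:43Z (stem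
check: no `…Close231WholeTorus…` / `…WholeTorusFlat…` stem; p31's `BIJ88NeumannPropagatorWholeTorus` is the `Ω = T` ↔ [I] (4.6.2) bridge, no
(2.31); notices to p31 and r01).  Occasion: r01 g24's drop-in (r18 INBOX 2026-08-22T21:55:06Z) — the `δG_k(□, T_η, 0)` input that p31's
`BIJ88NeumannPropagatorFlatClose231` HONEST SCOPE (ii) and r18's `C2S14-CLOSURE.md` §5 item 2 name as «not in the tree» for (2.31) with
`Ω = T_η` is now r01's `close112_flat_torus`.  Rows of `HOME/lit-balaban-r18/ROWS-C2.md` served (LOCATED MEMBERS, cells only; heads unchanged):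
**C2.Eq2.31** (head p08's hence-step), **C2.Eq2.35** (head p02's hence-step `BIJ88Close235Proof`).  Files USED BY NAME, nothing restated: r01's
`B4Delta112ZeroTorusCube` (`close112_flat_torus`, `close112_flat_torus_kernel`), r18's `BIJ88NeumannPropagatorFlatDecayLevel` (`decay110_flat_level`,
`decay110_flat_kernel_level`), p31's `BIJ88NeumannPropagatorFlatClose231` (`gLocT_sub_eq`, `gLocT_sub_mulVec_apply`, `abs_lam_le_one`,
`norm_rowSource_le`, `rowSource_ne_zero`), `BIJ88DeltaLocFlatClose235` (`norm_qMq_apply_le`, `norm_conj_qMatT_le`, `conj_qMatT_ne_zero`,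
`blockLower_le_T`, `exp_blockLower_level_le`, `scale_identity`, `deltaLocT_sub_deltaRegion_apply`), gen 15's `BIJ88DeltaLoc234Torus`
(`gLocT`, `qMatT`, `deltaLocT`, `deltaRegion`), `BIJ88NeumannPropagator227Torus.gBox`, `BIJ88NeumannPropagatorFlatDecayCube.cubeT`, p38's
`B5Ineq137Torus.T`, pv07's `B1RG242Torus.α`, `B1.aSeq`.

## The print (verbatim, p. 263; v1.1: the lead-in sentence now as printed — ref-5 D-g60-1)

*"The boundary conditions are always at a distance O(r(e_k)) from x₁, x₂, so a straightforward application of the random walk expansion of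
[6] shows that |(G_{k,loc}(u)f)(x)| ≦ ce^{−c dist(suppt f,x)}‖f‖_∞, (2.30) |(G_{k,loc}(u)f − G_k(Ω,u)f)(x)| ≦ e^{−cr(e_k)}e^{−c dist(suppt f,x)}‖f‖_∞,
(2.31) for dist(x,Ω^c) ≧ O(r(e_k)). [Each G_k(□_α,u) is close to G_k(Ω,u) for the relevant x₁, x₂, therefore the convex combination and
G_{k,loc} are close also.] We assume that u is smooth in the □_α's entering the sum in (2.27); for (2.31) we assume smoothness throughout the
subset Ω ⊂ T_η."* (the sentence *"This means that in a neighborhood of each □_α there exists an A, λ such that u = exp[ie_kη(A + ∂λ)] with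
|∂A|, |∂*A| ≦ O(p(e_k)). (2.32)"* FOLLOWS the display); *"Hence |Δ_{k,loc}(u;x₁,x₂) − Δ_k(Ω,u;x₁,x₂)| ≦ e^{−cr(e_k)}e^{−c|x₁−x₂|} for
dist({x₁,x₂},Ω^c) > O(r(e_k)), (2.35)"*.  (v1 of this header opened the first quotation with the words *"Furthermore, we have for u of the form
(2.32) that"* — a paraphrase, not print; corrected here, nothing else changed.)
Here `Ω = T_η` (so `Ω^c = ∅` and the condition `dist(x,Ω^c) ≥ O(r(e_k))` is void) and `u = 1^h` (flat, smooth everywhere).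

## What is proved (three theorems; 0 definitions; 0 `sorry`; no `Prop`-valued fact; standard axioms)

* **`close231_wholeTorus_flat_kernel_level`** — (2.31), KERNEL FORM, `Ω = T_η`: there are `δ₀, c₀ > 0` depending on `(d, L, a)` only such that on
  every torus of the series with `d + 1` directions and this (odd) `L`, at every level `1 ≤ k ≤ K`, for every finite family of no-wrap torus cubes
  `□_α = c_α·L^k + Π_i[0, L^kM_{α,i})` (each fitting and shorter than the torus — NO outer box, NO nesting data), all real weights `Σ_α|λ_α| ≤ 1`
  and cut-off `0 ≤ ζ″ ≤ 1` (gen 15's DATA of `gLocT`), every gauge function `h`, every site `x` and radii `R, R₁ ≥ 0` such that ON THE ROW OF `x`: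
  (i) `ζ″(x,y) ≠ 0 ⟹ Σ_αλ_α(x,y) = 1`, (ii) every cube ACTIVE at `(x,y)` contains `x` and `y` at sup-torus distance `≥ R` from `T_η∖□_α`,
  (iii) `ζ″(x,y) = 1` for `|x−y|_T ≤ R₁`: for every `y`,
  `‖G_{k,loc}(1^h;x,y) − G_k(T_η,1^h;x,y)‖ ≤ (L^kε)²·c₀(e^{−2δ₀R/L^k} + e^{−(δ₀/2)R₁/L^k})·e^{−(δ₀/2)|x−y|_T/L^k}`.
* **`opClose231_wholeTorus_flat_level`** — (2.31), OPERATOR FORM, `Ω = T_η`: under the same row-`x` hypotheses, for `f` with `‖f‖_∞ ≤ F` supported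
  at sup-torus distance `≥ D ≥ 0` from `x` and `S ∋` the cubes active on the row of `x` against `supp f`:
  `‖(G_{k,loc}(1^h)f − G_k(T_η,1^h)f)(x)‖ ≤ (L^kε)²·c₀(#S·e^{−2δ₀R/L^k} + e^{−(δ₀/2)R₁/L^k})·e^{−(δ₀/2)D/L^k}·F`.
* **`close235_wholeTorus_flat_level`** — (2.35), `Ω = T_η`: under the row hypotheses (i)–(iii) on every row `x ∈ B^k(y₁)` and `S ∋` the active cubes
  of those rows: `‖Δ_{k,loc}(1^h;y₁,y₂) − Δ_k(T_η,1^h;y₁,y₂)‖ ≤ A·a_k·c₀(#S·e^{−2δ₀R/L^k} + e^{−(δ₀/2)R₁/L^k})·e^{−(δ₀/2)|y₁−y₂|_{T^{(k)}}}`,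
  `A = α_kL^{kd}` (gen 15's counting normalization), `Δ_k(T_η,1^h) = deltaRegion A ε⁻¹ (1^h) k univ` (r18 g19's (2.36) object `decay236_torus_flat_level`).
At the printed radii `R, R₁ = r(e_k)L^k` the brackets are the print's `e^{−cr(e_k)}` at every level `k` (the lane's UNITS NOTE).

HONEST SCOPE / DIVERGENCE.  (i) FLAT / PURE-GAUGE `u = 1^h` ONLY (as every member of the flat lane); the (2.32)-smooth non-flat `u` needs [7]'s box
theorem at non-flat fields (p31 g19's non-flat chain, `BIJ88DeltaRegionSmallField236` is its first member).  (ii) Value / kernel members only: the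
covariant-derivative analogue of (2.31) for `Ω = T_η` waits for r01's `close112_flat_torus_deriv` (v1.1 p342535, in review at the time of writing)
— then it is p29's `deriv231_flat_cwt` proof with the same swap.  (iii) `d + 1 ≥ 1` directions, `L` odd `> 1` (r01's/r18's torus-side
conventions; p31's box members are stated for `L = ℓ + 1`).  (iv) Two constants for the print's one `c`, not optimized (`δ₀ = min`, `c₀ = max` of
the inputs', times `e^{δ₀/2}` in (2.35)).  (v) The hypotheses are the row hypotheses of p31's members with «deep inside `Ω₀`» read against
`T_η∖□_α`; for the printed data of record (p29's `BIJ88LocWeights227Torus`) they are discharged exactly as in p29's `close231_flat_kernel_cwt` —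
not instantiated here.  **v1.1 UPDATE of (ii) and (v):** both are now DONE in r18 g23's `BIJ88Close231WholeTorusFlatCwt` (p344568): the three
members of this file instantiated for the printed data AND the covariant-derivative analogue `deriv231_wholeTorus_flat_cwt`, at chart depth
`≥ R₀ + R` in the reference box — the extra `R` (not needed for p29's `Ω = Ω₀` members, so (v)'s «exactly as» was imprecise) is what makes row
hypothesis (ii) hold against `T_η ∖ □_α` for cubes clipped to `Ω₀` (`rowHyp_ii_torus` there).  Imports: r01's `B4Delta112ZeroTorusCube` (→ p31's
`BIJ88NeumannPropagatorFlatDecayCube`, b04/r01's B4 box files), r18's `BIJ88NeumannPropagatorFlatDecayLevel` (→ `BIJ88DeltaLocFlatClose235` →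
`BIJ88NeumannPropagatorFlatClose231`).  Literature + Mathlib only.  Unit `lit-balaban-r18` (literature-prover-lit-balaban-r18-g22-0, v1.1 doc-only
-g23-0), 2026-08-22.  v1.1 = v1 (p342936) with this module docstring corrected; every declaration and every other docstring byte-identical.  NOT
summit progress.
-/

open scoped BigOperators Matrix ComplexConjugate
open Finset Matrix

namespace Literature.MathematicalPhysics.QuantumFieldTheory.BalabanImbrieJaffe1984to88.BIJ88Close231WholeTorusFlat

open Literature.MathematicalPhysics.QuantumFieldTheory.Balaban1983to89
open BIJ88Sect3Statements (U1)
open BIJ85BlockAveragesTorus BIJ85BlockAveragesTorusK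
open BIJ88NeumannPropagator227Torus (gBox)
open BIJ88DeltaLoc234Torus (gLocT qMatT deltaLocT deltaRegion)
open BIJ88NeumannPropagatorFlatDecayCube (cubeT)
open BIJ88NeumannPropagatorFlatClose231 (gLocT_sub_eq gLocT_sub_mulVec_apply abs_lam_le_one norm_rowSource_le rowSource_ne_zero)
open BIJ88DeltaLocFlatClose235 (norm_qMq_apply_le norm_conj_qMatT_le conj_qMatT_ne_zero blockLower_le_T exp_blockLower_level_le
  scale_identity deltaLocT_sub_deltaRegion_apply)
open BIJ88NeumannPropagatorFlatDecayLevel (decay110_flat_level decay110_flat_kernel_level)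
open B4Delta112ZeroTorusCube (close112_flat_torus close112_flat_torus_kernel)
open GaugeField (gaugeAct)

noncomputable section

variable {d : ℕ}

/-- kernel: slower rates give larger exponentials, `e^{−δ′E} ≤ e^{−δE}` for `δ ≤ δ′`, `E ≥ 0`. [folklore] -/
private theorem exp_le_exp_of_rate {δ δ' E : ℝ} (hδ : δ ≤ δ') (hE : 0 ≤ E) : Real.exp (-(δ' * E)) ≤ Real.exp (-(δ * E)) :=
  Real.exp_le_exp.2 (neg_le_neg (mul_le_mul_of_nonneg_right hδ hE))

/-! ## §1 (2.31) with `Ω = T_η` at flat backgrounds, KERNEL form -/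

/-- **(2.31) WITH `Ω = T_η` AT EVERY PURE-GAUGE BACKGROUND, KERNEL FORM, IN LEVEL-`k` UNITS** (*"|(G_{k,loc}(u)f − G_k(Ω,u)f)(x)| ≤
e^{−cr(e_k)}e^{−c dist(suppt f,x)}‖f‖_∞, (2.31) … [Each G_k(□_α,u) is close to G_k(Ω,u) for the relevant x₁, x₂, therefore the convex combination
and G_{k,loc} are close also.]"*, p. 263, with the region `Ω` = the whole torus): there are `δ₀, c₀ > 0` depending on `(d, L, a)` only such that on
every torus of the series with `d + 1` directions and this `L`, at every level `1 ≤ k ≤ K`, for every finite family of no-wrap torus cubes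
`□_α = c_α·L^k + Π_i[0, L^kM_{α,i})` fitting and shorter than the torus, all real weights with `Σ_α|λ_α| ≤ 1` and cut-off `0 ≤ ζ″ ≤ 1`, every gauge
function `h`, every site `x` and radii `R, R₁ ≥ 0` such that ON THE ROW OF `x`: (i) `ζ″(x,y) ≠ 0 ⟹ Σ_αλ_α(x,y) = 1`, (ii) every cube ACTIVE at
`(x,y)` contains `x` and `y` at sup-torus distance `≥ R` from `T_η∖□_α`, (iii) `ζ″(x,y) = 1` for `|x−y|_T ≤ R₁`: for every `y`,
`‖G_{k,loc}(1^h;x,y) − G_k(T_η,1^h;x,y)‖ ≤ (L^kε)²·c₀(e^{−2δ₀R/L^k} + e^{−(δ₀/2)R₁/L^k})·e^{−(δ₀/2)|x−y|_T/L^k}` — p31's `close231_flat_kernel_level`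
proof with r01's `close112_flat_torus_kernel` ([6] (1.11)–(1.12) at `A = 0` for `□ ⊂ T_η`) for the active cubes and r18's
`decay110_flat_kernel_level` ([6] (1.10) for `G_k(T_η,1^h)`) for the tail beyond `R₁`. [cite: BalabanImbrieJaffe1988, (2.31) p.263] -/
theorem close231_wholeTorus_flat_kernel_level (d L : ℕ) (hL : Odd L ∧ 1 < L) {a : ℝ} (ha : 0 < a) :
    ∃ δ₀ c₀ : ℝ, 0 < δ₀ ∧ 0 < c₀ ∧ ∀ (P : Params) (hPd : P.d = d + 1), P.L = L →
      ∀ k : ℕ, 1 ≤ k → k ≤ P.K →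
      ∀ (ι : Type) [Fintype ι] (cube : ι → Finset (Balaban1983to89.Site P 0))
        (lam : ι → Balaban1983to89.Site P 0 → Balaban1983to89.Site P 0 → ℝ)
        (ζ'' : Balaban1983to89.Site P 0 → Balaban1983to89.Site P 0 → ℝ),
        (∀ α, ∃ c M : Fin (d + 1) → ℕ, (∀ i, 1 ≤ M i) ∧ (∀ i, c i * P.L ^ k + P.L ^ k * M i ≤ P.sitesPerDir 0) ∧
            (∀ i, P.L ^ k * M i < P.sitesPerDir 0) ∧ cube α = cubeT hPd (P.L ^ k) c fun i => P.L ^ k * M i) →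
        (∀ x y, ∑ α, |lam α x y| ≤ 1) → (∀ x y, 0 ≤ ζ'' x y ∧ ζ'' x y ≤ 1) →
      ∀ (h : GaugeTransf P 0 U1) (x : Balaban1983to89.Site P 0) (R R₁ : ℝ), 0 ≤ R → 0 ≤ R₁ →
        (∀ y, ζ'' x y ≠ 0 → ∑ α, lam α x y = 1) →
        (∀ α y, ζ'' x y * lam α x y ≠ 0 → x ∈ cube α ∧ y ∈ cube α ∧
            ∀ w, w ∉ cube α → R ≤ B5Ineq137Torus.T P 0 x w ∧ R ≤ B5Ineq137Torus.T P 0 y w) →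
        (∀ y, B5Ineq137Torus.T P 0 x y ≤ R₁ → ζ'' x y = 1) →
      ∀ y : Balaban1983to89.Site P 0,
        ‖gLocT (B1RG242Torus.α P a k * (P.L : ℝ) ^ (k * P.d)) P.eps⁻¹ (gaugeAct h (1 : GaugeField P 0 U1)) k cube lam ζ'' x y -
            gBox (B1RG242Torus.α P a k * (P.L : ℝ) ^ (k * P.d)) P.eps⁻¹ (gaugeAct h (1 : GaugeField P 0 U1)) k univ x y‖ ≤
          P.spacing k ^ 2 * (c₀ * (Real.exp (-(δ₀ * (((P.L : ℝ) ^ k)⁻¹ * (2 * R)))) + Real.exp (-(δ₀ / 2 * (((P.L : ℝ) ^ k)⁻¹ * R₁)))) *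
            Real.exp (-(δ₀ / 2 * (((P.L : ℝ) ^ k)⁻¹ * B5Ineq137Torus.T P 0 x y)))) := by
  obtain ⟨δ₁, c₁, hδ₁, hc₁, H1⟩ := close112_flat_torus_kernel d L hL ha
  obtain ⟨δ₂, c₂, hδ₂, hc₂, H2⟩ := decay110_flat_kernel_level (d + 1) L (by omega) hL ha
  refine ⟨min δ₁ δ₂, max c₁ c₂, lt_min hδ₁ hδ₂, lt_max_of_lt_left hc₁, ?_⟩
  intro P hPd hPL k hk1 hkK ι _ cube lam ζ hcube hlam hζ h x R R₁ hR hR₁ hcomp hdeep hcut y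
  set δ := min δ₁ δ₂ with hδdef
  set C := max c₁ c₂ with hCdef
  have hδ1 : δ ≤ δ₁ := min_le_left _ _
  have hδ2 : δ ≤ δ₂ := min_le_right _ _
  have hδ0 : 0 ≤ δ := (lt_min hδ₁ hδ₂).le
  have hC1 : c₁ ≤ C := le_max_left _ _
  have hC2 : c₂ ≤ C := le_max_right _ _
  have hC0 : 0 ≤ C := hc₁.le.trans hC1
  have hε : 0 < ((P.L : ℝ) ^ k)⁻¹ := inv_pos.mpr (pow_pos P.cast_L_pos _)
  have hs0 : 0 ≤ P.spacing k ^ 2 := sq_nonneg _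
  set Txy := B5Ineq137Torus.T P 0 x y with hTdef
  have hT0 : 0 ≤ Txy := B5Ineq137Torus.T_nonneg P 0 x y
  set G0 := gBox (B1RG242Torus.α P a k * (P.L : ℝ) ^ (k * P.d)) P.eps⁻¹ (gaugeAct h (1 : GaugeField P 0 U1)) k univ with hG0def
  -- the entry of the whole-torus propagator ([6] (1.10) for `G_k(T_η,1^h)`, r18 g19)
  have hG0 : ‖G0 x y‖ ≤ P.spacing k ^ 2 * (c₂ * Real.exp (-(δ₂ * (((P.L : ℝ) ^ k)⁻¹ * Txy)))) := by
    have h2 := H2 P hPd hPL k hk1 hkK h x y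
    calc ‖G0 x y‖ ≤ c₂ * P.spacing k ^ 2 * Real.exp (-(δ₂ * (Txy / (P.L : ℝ) ^ k))) := h2
      _ = P.spacing k ^ 2 * (c₂ * Real.exp (-(δ₂ * (((P.L : ℝ) ^ k)⁻¹ * Txy)))) := by rw [div_eq_inv_mul]; ring
  -- the active cubes are close to the whole torus at (x,y) ([6] (1.11)–(1.12) at A = 0 for □ ⊂ T_η, r01 g24)
  have hGa : ∀ α, ζ x y * lam α x y ≠ 0 →
      ‖gBox (B1RG242Torus.α P a k * (P.L : ℝ) ^ (k * P.d)) P.eps⁻¹ (gaugeAct h (1 : GaugeField P 0 U1)) k (cube α) x y - G0 x y‖ ≤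
        P.spacing k ^ 2 * (c₁ * Real.exp (-(δ₁ * (((P.L : ℝ) ^ k)⁻¹ * Txy))) * Real.exp (-(δ₁ * (((P.L : ℝ) ^ k)⁻¹ * (R + R))))) := by
    intro α hα
    obtain ⟨hxα, hyα, hw⟩ := hdeep α y hα
    obtain ⟨cα, M, hM, hfit, hN, hc⟩ := hcube α
    rw [hc] at hxα hyα hw
    rw [hc]
    have h1 := H1 P hPd hPL k hk1 hkK cα M hM hfit hN h x y hxα hyα R R hw
    calc ‖gBox (B1RG242Torus.α P a k * (P.L : ℝ) ^ (k * P.d)) P.eps⁻¹ (gaugeAct h (1 : GaugeField P 0 U1)) k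
              (cubeT hPd (P.L ^ k) cα fun i => P.L ^ k * M i) x y - G0 x y‖
        ≤ c₁ * P.spacing k ^ 2 * Real.exp (-(δ₁ * (Txy / (P.L : ℝ) ^ k))) * Real.exp (-(δ₁ * ((R + R) / (P.L : ℝ) ^ k))) := h1
      _ = P.spacing k ^ 2 * (c₁ * Real.exp (-(δ₁ * (((P.L : ℝ) ^ k)⁻¹ * Txy))) * Real.exp (-(δ₁ * (((P.L : ℝ) ^ k)⁻¹ * (R + R))))) := by
          rw [div_eq_inv_mul, div_eq_inv_mul]; ring
  rw [gLocT_sub_eq _ _ _ _ cube lam ζ G0 (hcomp y)]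
  -- term 1: the convex combination of the differences
  set B := P.spacing k ^ 2 * (c₁ * Real.exp (-(δ₁ * (((P.L : ℝ) ^ k)⁻¹ * Txy))) * Real.exp (-(δ₁ * (((P.L : ℝ) ^ k)⁻¹ * (R + R))))) with hBdef
  have hB0 : 0 ≤ B := by positivity
  have h1 : ‖(ζ x y : ℂ) * ∑ α, (lam α x y : ℂ) *
      (gBox (B1RG242Torus.α P a k * (P.L : ℝ) ^ (k * P.d)) P.eps⁻¹ (gaugeAct h (1 : GaugeField P 0 U1)) k (cube α) x y - G0 x y)‖ ≤ B := by
    have hz1 : |ζ x y| ≤ 1 := abs_le.2 ⟨by linarith [(hζ x y).1], (hζ x y).2⟩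
    calc ‖(ζ x y : ℂ) * ∑ α, (lam α x y : ℂ) *
          (gBox (B1RG242Torus.α P a k * (P.L : ℝ) ^ (k * P.d)) P.eps⁻¹ (gaugeAct h (1 : GaugeField P 0 U1)) k (cube α) x y - G0 x y)‖
        ≤ |ζ x y| * ∑ α, |lam α x y| *
          ‖gBox (B1RG242Torus.α P a k * (P.L : ℝ) ^ (k * P.d)) P.eps⁻¹ (gaugeAct h (1 : GaugeField P 0 U1)) k (cube α) x y - G0 x y‖ := by
            rw [norm_mul, Complex.norm_real, Real.norm_eq_abs]
            refine mul_le_mul_of_nonneg_left ((norm_sum_le _ _).trans (Finset.sum_le_sum fun α _ => ?_)) (abs_nonneg _)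
            rw [norm_mul, Complex.norm_real, Real.norm_eq_abs]
      _ = ∑ α, |ζ x y * lam α x y| *
          ‖gBox (B1RG242Torus.α P a k * (P.L : ℝ) ^ (k * P.d)) P.eps⁻¹ (gaugeAct h (1 : GaugeField P 0 U1)) k (cube α) x y - G0 x y‖ := by
            rw [Finset.mul_sum]
            exact Finset.sum_congr rfl fun α _ => by rw [abs_mul, mul_assoc]
      _ ≤ ∑ α, |ζ x y * lam α x y| * B := Finset.sum_le_sum fun α _ => by
            by_cases hα : ζ x y * lam α x y = 0
            · rw [hα, abs_zero, zero_mul, zero_mul]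
            · exact mul_le_mul_of_nonneg_left (hGa α hα) (abs_nonneg _)
      _ = |ζ x y| * (∑ α, |lam α x y|) * B := by
            rw [Finset.mul_sum, Finset.sum_mul]
            exact Finset.sum_congr rfl fun α _ => by rw [abs_mul]
      _ ≤ 1 * 1 * B := mul_le_mul_of_nonneg_right
            (mul_le_mul hz1 (hlam x y) (Finset.sum_nonneg fun α _ => abs_nonneg _) zero_le_one) hB0
      _ = B := by ring
  -- term 2: the tail of the whole-torus propagator beyond `R₁`
  have h2 : ‖((ζ x y : ℂ) - 1) * G0 x y‖ ≤
      P.spacing k ^ 2 * (c₂ * Real.exp (-(δ₂ / 2 * (((P.L : ℝ) ^ k)⁻¹ * R₁))) * Real.exp (-(δ₂ / 2 * (((P.L : ℝ) ^ k)⁻¹ * Txy)))) := by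
    by_cases hT1 : Txy ≤ R₁
    · rw [hcut y hT1]
      push_cast
      rw [sub_self, zero_mul, norm_zero]
      positivity
    · rw [not_le] at hT1
      have hz1 : ‖(ζ x y : ℂ) - 1‖ ≤ 1 := by
        rw [← Complex.ofReal_one, ← Complex.ofReal_sub, Complex.norm_real, Real.norm_eq_abs, abs_le]
        constructor <;> linarith [(hζ x y).1, (hζ x y).2]
      calc ‖((ζ x y : ℂ) - 1) * G0 x y‖ = ‖(ζ x y : ℂ) - 1‖ * ‖G0 x y‖ := norm_mul _ _
        _ ≤ 1 * (P.spacing k ^ 2 * (c₂ * Real.exp (-(δ₂ * (((P.L : ℝ) ^ k)⁻¹ * Txy))))) :=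
            mul_le_mul hz1 hG0 (norm_nonneg _) zero_le_one
        _ ≤ P.spacing k ^ 2 * (c₂ * Real.exp (-(δ₂ / 2 * (((P.L : ℝ) ^ k)⁻¹ * R₁))) * Real.exp (-(δ₂ / 2 * (((P.L : ℝ) ^ k)⁻¹ * Txy)))) := by
            rw [one_mul, mul_assoc c₂, ← Real.exp_add]
            refine mul_le_mul_of_nonneg_left (mul_le_mul_of_nonneg_left (Real.exp_le_exp.2 ?_) hc₂.le) hs0
            have : ((P.L : ℝ) ^ k)⁻¹ * R₁ ≤ ((P.L : ℝ) ^ k)⁻¹ * Txy := mul_le_mul_of_nonneg_left hT1.le hε.le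
            nlinarith
  -- assemble with the common rate `δ = min δ₁ δ₂` and constant `C = max c₁ c₂`
  have hεT : 0 ≤ ((P.L : ℝ) ^ k)⁻¹ * Txy := mul_nonneg hε.le hT0
  have h1' : B ≤ P.spacing k ^ 2 * (C * Real.exp (-(δ * (((P.L : ℝ) ^ k)⁻¹ * (2 * R)))) * Real.exp (-(δ / 2 * (((P.L : ℝ) ^ k)⁻¹ * Txy)))) := by
    rw [hBdef, mul_assoc c₁, mul_assoc C, mul_comm (Real.exp (-(δ₁ * (((P.L : ℝ) ^ k)⁻¹ * Txy)))) (Real.exp _)]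
    refine mul_le_mul_of_nonneg_left
      (mul_le_mul hC1 (mul_le_mul ?_ ?_ (Real.exp_pos _).le (Real.exp_pos _).le) (by positivity) hC0) hs0
    · rw [show R + R = 2 * R by ring]
      exact exp_le_exp_of_rate hδ1 (by positivity)
    · exact exp_le_exp_of_rate (by linarith) hεT
  have h2' : P.spacing k ^ 2 * (c₂ * Real.exp (-(δ₂ / 2 * (((P.L : ℝ) ^ k)⁻¹ * R₁))) * Real.exp (-(δ₂ / 2 * (((P.L : ℝ) ^ k)⁻¹ * Txy)))) ≤
      P.spacing k ^ 2 * (C * Real.exp (-(δ / 2 * (((P.L : ℝ) ^ k)⁻¹ * R₁))) * Real.exp (-(δ / 2 * (((P.L : ℝ) ^ k)⁻¹ * Txy)))) :=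
    mul_le_mul_of_nonneg_left
      (mul_le_mul (mul_le_mul hC2 (exp_le_exp_of_rate (by linarith) (by positivity)) (Real.exp_pos _).le hC0)
        (exp_le_exp_of_rate (by linarith) hεT) (Real.exp_pos _).le (by positivity)) hs0
  calc ‖(ζ x y : ℂ) * ∑ α, (lam α x y : ℂ) *
          (gBox (B1RG242Torus.α P a k * (P.L : ℝ) ^ (k * P.d)) P.eps⁻¹ (gaugeAct h (1 : GaugeField P 0 U1)) k (cube α) x y - G0 x y) +
        ((ζ x y : ℂ) - 1) * G0 x y‖
      ≤ B + P.spacing k ^ 2 * (c₂ * Real.exp (-(δ₂ / 2 * (((P.L : ℝ) ^ k)⁻¹ * R₁))) * Real.exp (-(δ₂ / 2 * (((P.L : ℝ) ^ k)⁻¹ * Txy)))) :=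
        (norm_add_le _ _).trans (add_le_add h1 h2)
    _ ≤ P.spacing k ^ 2 * (C * Real.exp (-(δ * (((P.L : ℝ) ^ k)⁻¹ * (2 * R)))) * Real.exp (-(δ / 2 * (((P.L : ℝ) ^ k)⁻¹ * Txy)))) +
        P.spacing k ^ 2 * (C * Real.exp (-(δ / 2 * (((P.L : ℝ) ^ k)⁻¹ * R₁))) * Real.exp (-(δ / 2 * (((P.L : ℝ) ^ k)⁻¹ * Txy)))) :=
        add_le_add h1' h2'
    _ = P.spacing k ^ 2 * (C * (Real.exp (-(δ * (((P.L : ℝ) ^ k)⁻¹ * (2 * R)))) + Real.exp (-(δ / 2 * (((P.L : ℝ) ^ k)⁻¹ * R₁)))) *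
        Real.exp (-(δ / 2 * (((P.L : ℝ) ^ k)⁻¹ * Txy)))) := by
        ring

/-! ## §2 (2.31) with `Ω = T_η` at flat backgrounds, OPERATOR form, with the active cubes of the row of `x` -/

/-- **(2.31) WITH `Ω = T_η` AT EVERY PURE-GAUGE BACKGROUND, OPERATOR FORM, IN LEVEL-`k` UNITS** (p. 263 (2.31) with `Ω = T_η`; *"The convex
combination … involves at most 2^d terms"*): there are `δ₀, c₀ > 0` depending on `(d, L, a)` only such that, under the row-`x` hypotheses
(i)–(iii) of `close231_wholeTorus_flat_kernel_level`, for every complex source `f` with `‖f‖_∞ ≤ F` supported at sup-torus distance `≥ D ≥ 0`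
from `x` and every finite set `S` of cube labels containing the cubes ACTIVE on the row of `x` against `f` (`ζ″(x,y)λ_α(x,y) ≠ 0`,
`f(y) ≠ 0 ⟹ α ∈ S`): `‖(G_{k,loc}(1^h)f − G_k(T_η,1^h)f)(x)‖ ≤ (L^kε)²·c₀(#S·e^{−2δ₀R/L^k} + e^{−(δ₀/2)R₁/L^k})e^{−(δ₀/2)D/L^k}F` — p31's
`opClose231_flat_level` proof with r01's `close112_flat_torus` cube by cube on the row sources `g_α = ζ″λ_αf` and r18's `decay110_flat_level`
(value member) for the tail `(ζ″ − 1)f` beyond `max(D, R₁)`. [cite: BalabanImbrieJaffe1988, (2.31) p.263] -/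
theorem opClose231_wholeTorus_flat_level (d L : ℕ) (hL : Odd L ∧ 1 < L) {a : ℝ} (ha : 0 < a) :
    ∃ δ₀ c₀ : ℝ, 0 < δ₀ ∧ 0 < c₀ ∧ ∀ (P : Params) (hPd : P.d = d + 1), P.L = L →
      ∀ k : ℕ, 1 ≤ k → k ≤ P.K →
      ∀ (ι : Type) [Fintype ι] (cube : ι → Finset (Balaban1983to89.Site P 0))
        (lam : ι → Balaban1983to89.Site P 0 → Balaban1983to89.Site P 0 → ℝ)
        (ζ'' : Balaban1983to89.Site P 0 → Balaban1983to89.Site P 0 → ℝ),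
        (∀ α, ∃ c M : Fin (d + 1) → ℕ, (∀ i, 1 ≤ M i) ∧ (∀ i, c i * P.L ^ k + P.L ^ k * M i ≤ P.sitesPerDir 0) ∧
            (∀ i, P.L ^ k * M i < P.sitesPerDir 0) ∧ cube α = cubeT hPd (P.L ^ k) c fun i => P.L ^ k * M i) →
        (∀ x y, ∑ α, |lam α x y| ≤ 1) → (∀ x y, 0 ≤ ζ'' x y ∧ ζ'' x y ≤ 1) →
      ∀ (h : GaugeTransf P 0 U1) (x : Balaban1983to89.Site P 0) (R R₁ : ℝ), 0 ≤ R → 0 ≤ R₁ →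
        (∀ y, ζ'' x y ≠ 0 → ∑ α, lam α x y = 1) →
        (∀ α y, ζ'' x y * lam α x y ≠ 0 → x ∈ cube α ∧ y ∈ cube α ∧
            ∀ w, w ∉ cube α → R ≤ B5Ineq137Torus.T P 0 x w ∧ R ≤ B5Ineq137Torus.T P 0 y w) →
        (∀ y, B5Ineq137Torus.T P 0 x y ≤ R₁ → ζ'' x y = 1) →
      ∀ (f : Balaban1983to89.Site P 0 → ℂ) (F D : ℝ), (∀ y, ‖f y‖ ≤ F) → 0 ≤ D → (∀ y, f y ≠ 0 → D ≤ B5Ineq137Torus.T P 0 x y) →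
      ∀ S : Finset ι, (∀ α y, ζ'' x y * lam α x y ≠ 0 → f y ≠ 0 → α ∈ S) →
        ‖(gLocT (B1RG242Torus.α P a k * (P.L : ℝ) ^ (k * P.d)) P.eps⁻¹ (gaugeAct h (1 : GaugeField P 0 U1)) k cube lam ζ'' *ᵥ f) x -
            (gBox (B1RG242Torus.α P a k * (P.L : ℝ) ^ (k * P.d)) P.eps⁻¹ (gaugeAct h (1 : GaugeField P 0 U1)) k univ *ᵥ f) x‖ ≤
          P.spacing k ^ 2 * (c₀ * (S.card * Real.exp (-(δ₀ * (((P.L : ℝ) ^ k)⁻¹ * (2 * R)))) + Real.exp (-(δ₀ / 2 * (((P.L : ℝ) ^ k)⁻¹ * R₁)))) *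
            Real.exp (-(δ₀ / 2 * (((P.L : ℝ) ^ k)⁻¹ * D))) * F) := by
  obtain ⟨δ₁, c₁, hδ₁, hc₁, H1⟩ := close112_flat_torus d L hL ha
  obtain ⟨δ₂, c₂, hδ₂, hc₂, H2⟩ := decay110_flat_level (d + 1) L (by omega) hL ha
  refine ⟨min δ₁ δ₂, max c₁ c₂, lt_min hδ₁ hδ₂, lt_max_of_lt_left hc₁, ?_⟩
  intro P hPd hPL k hk1 hkK ι _ cube lam ζ hcube hlam hζ h x R R₁ hR hR₁ hcomp hdeep hcut f F D hF hD hsupp S hS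
  set δ := min δ₁ δ₂ with hδdef
  set C := max c₁ c₂ with hCdef
  have hδ1 : δ ≤ δ₁ := min_le_left _ _
  have hδ2 : δ ≤ δ₂ := min_le_right _ _
  have hδ0 : 0 ≤ δ := (lt_min hδ₁ hδ₂).le
  have hC1 : c₁ ≤ C := le_max_left _ _
  have hC2 : c₂ ≤ C := le_max_right _ _
  have hC0 : 0 ≤ C := hc₁.le.trans hC1
  have hε : 0 < ((P.L : ℝ) ^ k)⁻¹ := inv_pos.mpr (pow_pos P.cast_L_pos _)
  have hF0 : 0 ≤ F := (norm_nonneg _).trans (hF x)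
  have hs0 : 0 ≤ P.spacing k ^ 2 := sq_nonneg _
  have hζ1 : ∀ y, |ζ x y| ≤ 1 := fun y => abs_le.2 ⟨by linarith [(hζ x y).1], (hζ x y).2⟩
  set G0 := gBox (B1RG242Torus.α P a k * (P.L : ℝ) ^ (k * P.d)) P.eps⁻¹ (gaugeAct h (1 : GaugeField P 0 U1)) k univ with hG0def
  rw [gLocT_sub_mulVec_apply _ _ _ _ cube lam ζ G0 f x hcomp]
  set B := P.spacing k ^ 2 * (c₁ * Real.exp (-(δ₁ * (((P.L : ℝ) ^ k)⁻¹ * D))) * Real.exp (-(δ₁ * (((P.L : ℝ) ^ k)⁻¹ * (R + R)))) * F) with hBdef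
  have hB0 : 0 ≤ B := by positivity
  -- cube by cube: r01's (1.11)–(1.12) at A = 0 for □_α ⊂ T_η on the row source g_α
  have hterm : ∀ α, ‖((gBox (B1RG242Torus.α P a k * (P.L : ℝ) ^ (k * P.d)) P.eps⁻¹ (gaugeAct h (1 : GaugeField P 0 U1)) k (cube α) - G0) *ᵥ
      fun y => (ζ x y : ℂ) * (lam α x y : ℂ) * f y) x‖ ≤ B := by
    intro α
    by_cases hex : ∃ y, ζ x y * lam α x y ≠ 0
    · obtain ⟨y₀, hy₀⟩ := hex
      obtain ⟨hxα, -, hwx⟩ := hdeep α y₀ hy₀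
      obtain ⟨cα, M, hM, hfit, hN, hc⟩ := hcube α
      have hyα : ∀ y, (ζ x y : ℂ) * (lam α x y : ℂ) * f y ≠ 0 → y ∈ cubeT hPd (P.L ^ k) cα (fun i => P.L ^ k * M i) :=
        fun y hy => hc ▸ (hdeep α y (rowSource_ne_zero hy).1).2.1
      have hwy : ∀ y, (ζ x y : ℂ) * (lam α x y : ℂ) * f y ≠ 0 →
          ∀ w, w ∉ cubeT hPd (P.L ^ k) cα (fun i => P.L ^ k * M i) → R ≤ B5Ineq137Torus.T P 0 y w :=
        fun y hy w hw' => ((hdeep α y (rowSource_ne_zero hy).1).2.2 w (hc ▸ hw')).2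
      rw [hc] at hxα hwx
      rw [Matrix.sub_mulVec, Pi.sub_apply, hc]
      have h1 := H1 P hPd hPL k hk1 hkK cα M hM hfit hN h x hxα _ F D R R
        (fun y => norm_rowSource_le (hζ1 y) (abs_lam_le_one hlam α x y) hF y)
        (fun y hy => by by_contra hne; exact hy (hyα y hne)) (fun y hy => hsupp y (rowSource_ne_zero hy).2)
        (fun w hw' => (hwx w hw').1) hwy
      calc ‖(gBox (B1RG242Torus.α P a k * (P.L : ℝ) ^ (k * P.d)) P.eps⁻¹ (gaugeAct h (1 : GaugeField P 0 U1)) k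
                (cubeT hPd (P.L ^ k) cα fun i => P.L ^ k * M i) *ᵥ fun y => (ζ x y : ℂ) * (lam α x y : ℂ) * f y) x -
              (G0 *ᵥ fun y => (ζ x y : ℂ) * (lam α x y : ℂ) * f y) x‖
          ≤ c₁ * P.spacing k ^ 2 * Real.exp (-(δ₁ * (D / (P.L : ℝ) ^ k))) * Real.exp (-(δ₁ * ((R + R) / (P.L : ℝ) ^ k))) * F := h1
        _ = B := by rw [hBdef, div_eq_inv_mul, div_eq_inv_mul]; ring
    · push Not at hex
      have h0 : (fun y => (ζ x y : ℂ) * (lam α x y : ℂ) * f y) = 0 := by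
        funext y; rw [← Complex.ofReal_mul, hex y, Complex.ofReal_zero, zero_mul]; rfl
      rw [h0, mulVec_zero, Pi.zero_apply, norm_zero]
      exact hB0
  have hzero : ∀ α, α ∉ S → ((gBox (B1RG242Torus.α P a k * (P.L : ℝ) ^ (k * P.d)) P.eps⁻¹ (gaugeAct h (1 : GaugeField P 0 U1)) k (cube α)
      - G0) *ᵥ fun y => (ζ x y : ℂ) * (lam α x y : ℂ) * f y) x = 0 := by
    intro α hα
    have h0 : (fun y => (ζ x y : ℂ) * (lam α x y : ℂ) * f y) = 0 := by
      funext y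
      by_contra hne
      exact hα (hS α y (rowSource_ne_zero hne).1 (rowSource_ne_zero hne).2)
    rw [h0, mulVec_zero, Pi.zero_apply]
  have hsum : ‖∑ α, ((gBox (B1RG242Torus.α P a k * (P.L : ℝ) ^ (k * P.d)) P.eps⁻¹ (gaugeAct h (1 : GaugeField P 0 U1)) k (cube α) - G0) *ᵥ
      fun y => (ζ x y : ℂ) * (lam α x y : ℂ) * f y) x‖ ≤ S.card * B := by
    rw [← Finset.sum_subset (Finset.subset_univ S) (fun α _ hα => hzero α hα)]
    calc ‖∑ α ∈ S, ((gBox (B1RG242Torus.α P a k * (P.L : ℝ) ^ (k * P.d)) P.eps⁻¹ (gaugeAct h (1 : GaugeField P 0 U1)) k (cube α) - G0) *ᵥ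
            fun y => (ζ x y : ℂ) * (lam α x y : ℂ) * f y) x‖
        ≤ ∑ α ∈ S, ‖((gBox (B1RG242Torus.α P a k * (P.L : ℝ) ^ (k * P.d)) P.eps⁻¹ (gaugeAct h (1 : GaugeField P 0 U1)) k (cube α) - G0) *ᵥ
            fun y => (ζ x y : ℂ) * (lam α x y : ℂ) * f y) x‖ := norm_sum_le _ _
      _ ≤ ∑ α ∈ S, B := Finset.sum_le_sum fun α _ => hterm α
      _ = S.card * B := by rw [Finset.sum_const, nsmul_eq_mul]
  -- the tail `(ζ″ − 1)f` against the whole-torus propagator ([6] (1.10) for G_k(T_η,1^h), r18 g19)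
  have htail : ‖(G0 *ᵥ fun y => ((ζ x y : ℂ) - 1) * f y) x‖ ≤ P.spacing k ^ 2 * (c₂ * Real.exp (-(δ₂ * (((P.L : ℝ) ^ k)⁻¹ * max D R₁))) * F) := by
    have hD' : 0 ≤ max D R₁ := hD.trans (le_max_left _ _)
    have hFg : ∀ y, ‖((ζ x y : ℂ) - 1) * f y‖ ≤ F := fun y => by
      have hz1 : ‖(ζ x y : ℂ) - 1‖ ≤ 1 := by
        rw [← Complex.ofReal_one, ← Complex.ofReal_sub, Complex.norm_real, Real.norm_eq_abs, abs_le]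
        constructor <;> linarith [(hζ x y).1, (hζ x y).2]
      calc ‖((ζ x y : ℂ) - 1) * f y‖ = ‖(ζ x y : ℂ) - 1‖ * ‖f y‖ := norm_mul _ _
        _ ≤ 1 * F := mul_le_mul hz1 (hF y) (norm_nonneg _) zero_le_one
        _ = F := one_mul F
    have hsg : ∀ y, ((ζ x y : ℂ) - 1) * f y ≠ 0 → max D R₁ ≤ B5Ineq137Torus.T P 0 x y := fun y hy => by
      have hf : f y ≠ 0 := fun hf => hy (by rw [hf, mul_zero])
      have hz : ζ x y ≠ 1 := fun h1 => hy (by rw [h1]; push_cast; rw [sub_self, zero_mul])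
      exact max_le (hsupp y hf) (le_of_lt (lt_of_not_ge fun hle => hz (hcut y hle)))
    have h2 := (H2 P hPd hPL k hk1 hkK h x (fun y => ((ζ x y : ℂ) - 1) * f y) F (max D R₁) hFg hD' hsg).1
    calc ‖(G0 *ᵥ fun y => ((ζ x y : ℂ) - 1) * f y) x‖
        ≤ c₂ * P.spacing k ^ 2 * Real.exp (-(δ₂ * (max D R₁ / (P.L : ℝ) ^ k))) * F := h2
      _ = P.spacing k ^ 2 * (c₂ * Real.exp (-(δ₂ * (((P.L : ℝ) ^ k)⁻¹ * max D R₁))) * F) := by rw [div_eq_inv_mul]; ring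
  have hεD : 0 ≤ ((P.L : ℝ) ^ k)⁻¹ * D := mul_nonneg hε.le hD
  have hsum' : (S.card : ℝ) * B ≤
      P.spacing k ^ 2 * (C * (S.card * Real.exp (-(δ * (((P.L : ℝ) ^ k)⁻¹ * (2 * R))))) * Real.exp (-(δ / 2 * (((P.L : ℝ) ^ k)⁻¹ * D))) * F) := by
    have h1 : c₁ * Real.exp (-(δ₁ * (((P.L : ℝ) ^ k)⁻¹ * D))) * Real.exp (-(δ₁ * (((P.L : ℝ) ^ k)⁻¹ * (R + R)))) * F ≤
        C * Real.exp (-(δ * (((P.L : ℝ) ^ k)⁻¹ * (2 * R)))) * Real.exp (-(δ / 2 * (((P.L : ℝ) ^ k)⁻¹ * D))) * F := by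
      rw [mul_assoc c₁, mul_comm (Real.exp _) (Real.exp _), ← mul_assoc c₁]
      refine mul_le_mul_of_nonneg_right (mul_le_mul (mul_le_mul hC1 ?_ (Real.exp_pos _).le hC0) ?_ (Real.exp_pos _).le
        (by positivity)) hF0
      · rw [show R + R = 2 * R by ring]
        exact exp_le_exp_of_rate hδ1 (by positivity)
      · exact exp_le_exp_of_rate (by linarith) hεD
    calc (S.card : ℝ) * B = P.spacing k ^ 2 * (S.card * (c₁ * Real.exp (-(δ₁ * (((P.L : ℝ) ^ k)⁻¹ * D))) * Real.exp (-(δ₁ * (((P.L : ℝ) ^ k)⁻¹ * (R + R)))) * F)) := by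
          rw [hBdef]; ring
      _ ≤ P.spacing k ^ 2 * (S.card * (C * Real.exp (-(δ * (((P.L : ℝ) ^ k)⁻¹ * (2 * R)))) * Real.exp (-(δ / 2 * (((P.L : ℝ) ^ k)⁻¹ * D))) * F)) :=
          mul_le_mul_of_nonneg_left (mul_le_mul_of_nonneg_left h1 (Nat.cast_nonneg _)) hs0
      _ = P.spacing k ^ 2 * (C * (S.card * Real.exp (-(δ * (((P.L : ℝ) ^ k)⁻¹ * (2 * R))))) * Real.exp (-(δ / 2 * (((P.L : ℝ) ^ k)⁻¹ * D))) * F) := by ring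
  have htail' : P.spacing k ^ 2 * (c₂ * Real.exp (-(δ₂ * (((P.L : ℝ) ^ k)⁻¹ * max D R₁))) * F) ≤
      P.spacing k ^ 2 * (C * Real.exp (-(δ / 2 * (((P.L : ℝ) ^ k)⁻¹ * R₁))) * Real.exp (-(δ / 2 * (((P.L : ℝ) ^ k)⁻¹ * D))) * F) := by
    refine mul_le_mul_of_nonneg_left (mul_le_mul_of_nonneg_right ?_ hF0) hs0
    rw [mul_assoc C, ← Real.exp_add]
    refine mul_le_mul hC2 (Real.exp_le_exp.2 ?_) (Real.exp_pos _).le hC0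
    have hm1 : D ≤ max D R₁ := le_max_left _ _
    have hm2 : R₁ ≤ max D R₁ := le_max_right _ _
    have hm0 : 0 ≤ ((P.L : ℝ) ^ k)⁻¹ * max D R₁ := mul_nonneg hε.le (hD.trans hm1)
    nlinarith [mul_le_mul_of_nonneg_left hm1 hε.le, mul_le_mul_of_nonneg_left hm2 hε.le, mul_nonneg hδ0 hm0,
      mul_le_mul_of_nonneg_right hδ2 hm0]
  calc ‖∑ α, ((gBox (B1RG242Torus.α P a k * (P.L : ℝ) ^ (k * P.d)) P.eps⁻¹ (gaugeAct h (1 : GaugeField P 0 U1)) k (cube α) - G0) *ᵥ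
            fun y => (ζ x y : ℂ) * (lam α x y : ℂ) * f y) x + (G0 *ᵥ fun y => ((ζ x y : ℂ) - 1) * f y) x‖
      ≤ S.card * B + P.spacing k ^ 2 * (c₂ * Real.exp (-(δ₂ * (((P.L : ℝ) ^ k)⁻¹ * max D R₁))) * F) :=
        (norm_add_le _ _).trans (add_le_add hsum htail)
    _ ≤ P.spacing k ^ 2 * (C * (S.card * Real.exp (-(δ * (((P.L : ℝ) ^ k)⁻¹ * (2 * R))))) * Real.exp (-(δ / 2 * (((P.L : ℝ) ^ k)⁻¹ * D))) * F) +
        P.spacing k ^ 2 * (C * Real.exp (-(δ / 2 * (((P.L : ℝ) ^ k)⁻¹ * R₁))) * Real.exp (-(δ / 2 * (((P.L : ℝ) ^ k)⁻¹ * D))) * F) := add_le_add hsum' htail'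
    _ = P.spacing k ^ 2 * (C * (S.card * Real.exp (-(δ * (((P.L : ℝ) ^ k)⁻¹ * (2 * R)))) + Real.exp (-(δ / 2 * (((P.L : ℝ) ^ k)⁻¹ * R₁)))) *
        Real.exp (-(δ / 2 * (((P.L : ℝ) ^ k)⁻¹ * D))) * F) := by ring

/-! ## §3 (2.35) with `Ω = T_η` at flat backgrounds: `Δ_{k,loc}(1^h)` against the whole-torus region form `Δ_k(T_η,1^h)` -/

/-- **(2.35) WITH `Ω = T_η` FOR GEN 15's `Δ_{k,loc}(1^h)` AGAINST `Δ_k(T_η,1^h)`, IN LEVEL-`k` UNITS** (*"Hence |Δ_{k,loc}(u;x₁,x₂) −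
Δ_k(Ω,u;x₁,x₂)| ≤ e^{−cr(e_k)}e^{−c|x₁−x₂|} for dist({x₁,x₂},Ω^c) > O(r(e_k)), (2.35)"*, p. 263, `Ω = T_η`): there are `δ₀, c₀ > 0` depending on
`(d, L, a)` only such that, for every finite family of no-wrap torus cubes fitting and shorter than the torus, weights `Σ_α|λ_α| ≤ 1`, cut-off
`0 ≤ ζ″ ≤ 1`, every `h`, radii `R, R₁ ≥ 0`, unit-lattice points `y₁, y₂ ∈ T^{(k)}` with the row hypotheses (i)–(iii) of
`close231_wholeTorus_flat_kernel_level` on every row `x ∈ B^k(y₁)` and `S ∋` the cubes active on those rows: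
`‖Δ_{k,loc}(1^h;y₁,y₂) − Δ_k(T_η,1^h;y₁,y₂)‖ ≤ A·a_k·c₀(#S·e^{−2δ₀R/L^k} + e^{−(δ₀/2)R₁/L^k})·e^{−(δ₀/2)|y₁−y₂|_{T^{(k)}}}`, `A = α_kL^{kd}`,
`Δ_k(T_η,1^h) = deltaRegion A ε⁻¹ (1^h) k univ` — p31's `close235_flat_level` proof (block-sum sandwich `norm_qMq_apply_le`, scale identity,
block metric in level-`k` units) on §2's operator form. [cite: BalabanImbrieJaffe1988, (2.35) p.263] -/
theorem close235_wholeTorus_flat_level (d L : ℕ) (hL : Odd L ∧ 1 < L) {a : ℝ} (ha : 0 < a) :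
    ∃ δ₀ c₀ : ℝ, 0 < δ₀ ∧ 0 < c₀ ∧ ∀ (P : Params) (hPd : P.d = d + 1), P.L = L →
      ∀ k : ℕ, 1 ≤ k → k ≤ P.K →
      ∀ (ι : Type) [Fintype ι] (cube : ι → Finset (Balaban1983to89.Site P 0))
        (lam : ι → Balaban1983to89.Site P 0 → Balaban1983to89.Site P 0 → ℝ)
        (ζ'' : Balaban1983to89.Site P 0 → Balaban1983to89.Site P 0 → ℝ),
        (∀ α, ∃ c M : Fin (d + 1) → ℕ, (∀ i, 1 ≤ M i) ∧ (∀ i, c i * P.L ^ k + P.L ^ k * M i ≤ P.sitesPerDir 0) ∧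
            (∀ i, P.L ^ k * M i < P.sitesPerDir 0) ∧ cube α = cubeT hPd (P.L ^ k) c fun i => P.L ^ k * M i) →
        (∀ x y, ∑ α, |lam α x y| ≤ 1) → (∀ x y, 0 ≤ ζ'' x y ∧ ζ'' x y ≤ 1) →
      ∀ (h : GaugeTransf P 0 U1) (R R₁ : ℝ), 0 ≤ R → 0 ≤ R₁ → ∀ (y₁ y₂ : Balaban1983to89.Site P (0 + k)),
        (∀ x ∈ blockK k y₁, ∀ y, ζ'' x y ≠ 0 → ∑ α, lam α x y = 1) →
        (∀ x ∈ blockK k y₁, ∀ α y, ζ'' x y * lam α x y ≠ 0 → x ∈ cube α ∧ y ∈ cube α ∧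
            ∀ w, w ∉ cube α → R ≤ B5Ineq137Torus.T P 0 x w ∧ R ≤ B5Ineq137Torus.T P 0 y w) →
        (∀ x ∈ blockK k y₁, ∀ y, B5Ineq137Torus.T P 0 x y ≤ R₁ → ζ'' x y = 1) →
      ∀ S : Finset ι, (∀ x ∈ blockK k y₁, ∀ α y, ζ'' x y * lam α x y ≠ 0 → α ∈ S) →
        ‖deltaLocT (B1RG242Torus.α P a k * (P.L : ℝ) ^ (k * P.d)) P.eps⁻¹ (gaugeAct h (1 : GaugeField P 0 U1)) k cube lam ζ'' y₁ y₂ -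
            deltaRegion (B1RG242Torus.α P a k * (P.L : ℝ) ^ (k * P.d)) P.eps⁻¹ (gaugeAct h (1 : GaugeField P 0 U1)) k univ y₁ y₂‖ ≤
          (B1RG242Torus.α P a k * (P.L : ℝ) ^ (k * P.d)) * (B1.aSeq a P.L k * c₀ *
            (S.card * Real.exp (-(δ₀ * (((P.L : ℝ) ^ k)⁻¹ * (2 * R)))) + Real.exp (-(δ₀ / 2 * (((P.L : ℝ) ^ k)⁻¹ * R₁)))) *
              Real.exp (-(δ₀ / 2 * (B5Ineq137Torus.T P (0 + k) y₁ y₂)))) := by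
  obtain ⟨δ₀, c₀, hδ₀, hc₀, H⟩ := opClose231_wholeTorus_flat_level d L hL ha
  refine ⟨δ₀, c₀ * Real.exp (δ₀ / 2), hδ₀, by positivity, ?_⟩
  intro P hPd hPL k hk1 hkK ι _ cube lam ζ hcube hlam hζ h R R₁ hR hR₁ y₁ y₂ hcomp hdeep hcut S hS
  have hk : 0 + k ≤ P.m + P.K := by omega
  set A := B1RG242Torus.α P a k * (P.L : ℝ) ^ (k * P.d) with hAdef
  have hak : 0 < B1.aSeq a P.L k := B1.aSeq_pos ha (B1RG242Torus.one_lt_cast_L P) hk1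
  have hα : 0 < B1RG242Torus.α P a k := mul_pos hak (inv_pos.mpr (pow_pos (P.spacing_pos k) 2))
  have hA0 : 0 ≤ A := (mul_pos hα (pow_pos P.cast_L_pos _)).le
  set Gloc := gLocT A P.eps⁻¹ (gaugeAct h (1 : GaugeField P 0 U1)) k cube lam ζ with hGlocdef
  set G0 := gBox A P.eps⁻¹ (gaugeAct h (1 : GaugeField P 0 U1)) k univ with hG0def
  set Dl := max 0 (((P.L : ℝ) ^ k) * B5Ineq137Torus.T P (0 + k) y₁ y₂ - (((P.L : ℝ) ^ k) - 1)) with hDldef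
  have hDl0 : 0 ≤ Dl := le_max_left _ _
  set E := c₀ * (S.card * Real.exp (-(δ₀ * (((P.L : ℝ) ^ k)⁻¹ * (2 * R)))) + Real.exp (-(δ₀ / 2 * (((P.L : ℝ) ^ k)⁻¹ * R₁)))) with hEdef
  have hE0 : 0 ≤ E := by positivity
  have hSandwich : ‖(qMatT (gaugeAct h (1 : GaugeField P 0 U1)) k * (Gloc - G0) * (qMatT (gaugeAct h (1 : GaugeField P 0 U1)) k)ᴴ) y₁ y₂‖ ≤
      P.spacing k ^ 2 * (E * Real.exp (-(δ₀ / 2 * (((P.L : ℝ) ^ k)⁻¹ * Dl))) * ((P.L : ℝ) ^ (k * P.d))⁻¹) := by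
    refine norm_qMq_apply_le hk _ (Gloc - G0) y₁ y₂ fun x hx => ?_
    rw [Matrix.sub_mulVec, Pi.sub_apply]
    exact H P hPd hPL k hk1 hkK ι cube lam ζ hcube hlam hζ h x R R₁ hR hR₁ (hcomp x hx) (hdeep x hx) (hcut x hx)
      _ _ Dl (fun x' => norm_conj_qMatT_le _ k y₂ x') hDl0 (fun x' hx' => blockLower_le_T hk hx (conj_qMatT_ne_zero _ k hx'))
      S (fun α y hαy _ => hS x hx α y hαy)
  have hexp := exp_blockLower_level_le y₁ y₂ (half_pos hδ₀).le
  rw [← hDldef] at hexp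
  rw [deltaLocT_sub_deltaRegion_apply, norm_neg, norm_mul, norm_pow, Complex.norm_real, Real.norm_eq_abs, abs_of_nonneg hA0]
  have e := scale_identity P a k
  rw [← hAdef] at e
  calc A ^ 2 * ‖(qMatT (gaugeAct h (1 : GaugeField P 0 U1)) k * (Gloc - G0) * (qMatT (gaugeAct h (1 : GaugeField P 0 U1)) k)ᴴ) y₁ y₂‖
      ≤ A ^ 2 * (P.spacing k ^ 2 * (E * Real.exp (-(δ₀ / 2 * (((P.L : ℝ) ^ k)⁻¹ * Dl))) * ((P.L : ℝ) ^ (k * P.d))⁻¹)) :=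
        mul_le_mul_of_nonneg_left hSandwich (sq_nonneg _)
    _ = A ^ 2 * (((P.L : ℝ) ^ (k * P.d))⁻¹ * P.spacing k ^ 2) * (E * Real.exp (-(δ₀ / 2 * (((P.L : ℝ) ^ k)⁻¹ * Dl)))) := by ring
    _ = A * B1.aSeq a P.L k * (E * Real.exp (-(δ₀ / 2 * (((P.L : ℝ) ^ k)⁻¹ * Dl)))) := by rw [e]
    _ ≤ A * B1.aSeq a P.L k * (E * (Real.exp (δ₀ / 2) * Real.exp (-(δ₀ / 2 * (B5Ineq137Torus.T P (0 + k) y₁ y₂))))) :=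
        mul_le_mul_of_nonneg_left (mul_le_mul_of_nonneg_left hexp hE0) (mul_nonneg hA0 hak.le)
    _ = A * (B1.aSeq a P.L k * (c₀ * Real.exp (δ₀ / 2)) *
          (S.card * Real.exp (-(δ₀ * (((P.L : ℝ) ^ k)⁻¹ * (2 * R)))) + Real.exp (-(δ₀ / 2 * (((P.L : ℝ) ^ k)⁻¹ * R₁)))) *
            Real.exp (-(δ₀ / 2 * (B5Ineq137Torus.T P (0 + k) y₁ y₂)))) := by rw [hEdef]; ring

end

end Literature.MathematicalPhysics.QuantumFieldTheory.BalabanImbrieJaffe1984to88.BIJ88Close231WholeTorusFlat
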